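import Summits.RiemannHypothesis.RiemannHypothesis.Theorems.WeilColumnThetaMajorantD2
import HarnessLib

/-!
# The B-spline Fourier transform WITH THE SINE KEPT (input E1 of the tier-2 theta certificate; RH-FREE)

WEIL column (LADDER-RH, W-P(P2); route `WeilSemilocal`, tier-2 twin residue below the dodger floor, items 19172 / 19185;
HOME/cc-s2-1/gen22/TIER2-KERNEL-SPEC.md §3/§5 "NEW for tier 2: E1", THETA-CERT-cc6 §E1). Tier 1 (`WeilColumnBSplineFourier`,
p416577) bounds `‖𝓕(unif_c)(ξ)‖ ≤ 1/(2πc|ξ|)`, dropping the sine; tier 2 keeps it: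

* `intervalIntegral_cexp_window` — `∫_{−c}^{c} e^{−2πiξx} dx = sin(2πcξ)/(πξ)` (`ξ ≠ 0`);
* `fourier_unifDensity_eq` / `norm_fourier_unifDensity_eq` — **`𝓕(unif_c)(ξ) = sin(2πcξ)/(2πcξ)` EXACTLY**, so
  `‖𝓕(bsplineDensity c k)(ξ)‖ = (|sin(2πcξ)|/(2πc|ξ|))^{k+1}` (`norm_fourier_bsplineDensity_eq`);
* `norm_fourier_profile_le_sine` — `‖𝓕h(ξ)‖ ≤ ((1+|α|)/(π|ξ|))·(|sin(2π(ε/m)ξ)|·m/(2πε|ξ|))^m` for the PART XIX profile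
  `h = h₀ ⋆ bsplineDensity (ε/m) (m−1)` (E1's `ρ̂(ζ) = (sin(ζ/m)/(ζ/m))^m EXACTLY`);
* `norm_fourier_mulId_bsplineDensity_le_sine`, `norm_fourier_momentProfile_le_sine` — the first-moment (derivative-majorant)
  versions with `|sin|^{m−1}` kept (E1's `|ρ̂′(ζ)| ≤ |sin(ζ/m)|^{m−1}(m/ζ)^m(1 + m/ζ)`): for `φ(y) = y·h′(y)`,
  `‖𝓕φ(ξ)‖ ≤ (2+2α)·X^m·(c₂ s^m + ε s^{m−1}(1+X))`, `X = m/(2πε|ξ|)`, `s = |sin(2π(ε/m)ξ)|`;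
* `summable_tsum_int_norm_le_of_bound`, `tsum_succ_le_sum_Ico_add_sub` — the lattice-sum bookkeeping that turns a symmetric
  termwise bound `‖F(n/u)‖ ≤ a_{|n|}` into `Σ_{n∈ℤ}‖F(n/u)‖ ≤ 2Σ_{k≥1}a_k ≤ 2[Σ_{k=1}^{K}a_k + (Σ_{k≥1}b_k − Σ_{k=1}^{K}b_k)]`
  for a summable majorant `b ≥ a` (the `K`-harmonic split of E1's `S(t)`, residue `ζ(m+1) − Σ_{k≤K}k^{−(m+1)}`).
Everything is Mathlib-level Fourier analysis; nothing here bears on the truth of RH.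
-/

set_option linter.dupNamespace false

noncomputable section

open MeasureTheory Set Complex Filter intervalIntegral Finset
open scoped Real FourierTransform
open Literature.NumberTheory.LFunctions

namespace Summit.RiemannHypothesis.RiemannHypothesis.Theorems.WeilColumn.ThetaMellin

/-! ## The window integral and the exact transform of the uniform density -/

/-- `∫_{−c}^{c} e^{−2πiξx} dx = sin(2πcξ)/(πξ)` for `ξ ≠ 0`. [folklore] -/
theorem intervalIntegral_cexp_window (c : ℝ) {ξ : ℝ} (hξ : ξ ≠ 0) :
    ∫ x in (-c)..c, Complex.exp (↑(-2 * π * x * ξ) * Complex.I) = ((Real.sin (2 * π * c * ξ) / (π * ξ) : ℝ) : ℂ) := by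
  set a : ℂ := ↑(-2 * π * ξ) * Complex.I with ha
  have hπξ : ((π * ξ : ℝ) : ℂ) ≠ 0 := by exact_mod_cast mul_ne_zero Real.pi_ne_zero hξ
  have ha0 : a ≠ 0 := by
    rw [ha]
    refine mul_ne_zero ?_ Complex.I_ne_zero
    have : (-2 * π * ξ : ℝ) ≠ 0 := by simp [Real.pi_ne_zero, hξ]
    exact_mod_cast this
  have hint : (∫ x in (-c)..c, Complex.exp (↑(-2 * π * x * ξ) * Complex.I)) = ∫ x in (-c)..c, Complex.exp (a * x) := by
    refine intervalIntegral.integral_congr fun x _ => ?_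
    simp only [ha]; congr 1; push_cast; ring
  rw [hint, integral_exp_mul_complex ha0]
  set z : ℂ := ((2 * π * c * ξ : ℝ) : ℂ) with hz
  have e1 : a * (c : ℂ) = -z * Complex.I := by rw [ha, hz]; push_cast; ring
  have e2 : a * ((-c : ℝ) : ℂ) = z * Complex.I := by rw [ha, hz]; push_cast; ring
  have hinv : a⁻¹ = Complex.I / (2 * ((π * ξ : ℝ) : ℂ)) := by
    refine inv_eq_of_mul_eq_one_right ?_
    rw [ha, div_eq_mul_inv]
    have : (↑(-2 * π * ξ) : ℂ) = -2 * ((π * ξ : ℝ) : ℂ) := by push_cast; ring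
    rw [this]
    field_simp
    rw [Complex.I_sq]; ring
  -- `e^{−iz} − e^{iz} = −2i sin z`
  have hsin : Complex.exp (-z * Complex.I) - Complex.exp (z * Complex.I) = -2 * Complex.I * Complex.sin z := by
    rw [Complex.sin]
    have : -2 * Complex.I * ((Complex.exp (-z * Complex.I) - Complex.exp (z * Complex.I)) * Complex.I / 2) =
        -(Complex.I * Complex.I) * (Complex.exp (-z * Complex.I) - Complex.exp (z * Complex.I)) := by ring
    rw [this, Complex.I_mul_I]; ring
  rw [div_eq_mul_inv, hinv, e1, e2, hsin, hz, ← Complex.ofReal_sin]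
  push_cast
  field_simp
  rw [show Complex.I ^ 2 = -1 from Complex.I_sq]
  ring

/-- **`𝓕(unif_c)(ξ) = sin(2πcξ)/(2πcξ)`** (`c > 0`, `ξ ≠ 0`): the transform of the uniform density on `[−c, c]`, sine kept. [folklore] -/
theorem fourier_unifDensity_eq {c : ℝ} (hc : 0 < c) {ξ : ℝ} (hξ : ξ ≠ 0) :
    𝓕 (unifDensity c) ξ = ((Real.sin (2 * π * c * ξ) / (2 * π * c * ξ) : ℝ) : ℂ) := by
  rw [unifDensity, fourier_indicatorConst (by linarith) _ ξ, intervalIntegral_cexp_window c hξ]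
  have hπξ : π * ξ ≠ 0 := mul_ne_zero Real.pi_ne_zero hξ
  have e : (2 * c)⁻¹ * (Real.sin (2 * π * c * ξ) / (π * ξ)) = Real.sin (2 * π * c * ξ) / (2 * π * c * ξ) := by
    field_simp
  rw [← e]
  push_cast
  ring

/-- **`‖𝓕(unif_c)(ξ)‖ = |sin(2πcξ)|/(2πc|ξ|)`** (`c > 0`, `ξ ≠ 0`). [folklore] -/
theorem norm_fourier_unifDensity_eq {c : ℝ} (hc : 0 < c) {ξ : ℝ} (hξ : ξ ≠ 0) :
    ‖𝓕 (unifDensity c) ξ‖ = |Real.sin (2 * π * c * ξ)| / (2 * π * c * |ξ|) := by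
  rw [fourier_unifDensity_eq hc hξ, Complex.norm_real, Real.norm_eq_abs, abs_div, abs_mul,
    abs_of_pos (by positivity : (0 : ℝ) < 2 * π * c)]

/-- **`‖𝓕(bsplineDensity c k)(ξ)‖ = (|sin(2πcξ)|/(2πc|ξ|))^{k+1}`** (`c > 0`, `ξ ≠ 0`): E1's `|ρ̂(ζ)| = |sin(ζ/m)/(ζ/m)|^m` exactly.
[folklore] -/
theorem norm_fourier_bsplineDensity_eq {c : ℝ} (hc : 0 < c) (k : ℕ) {ξ : ℝ} (hξ : ξ ≠ 0) :
    ‖𝓕 (bsplineDensity c k) ξ‖ = (|Real.sin (2 * π * c * ξ)| / (2 * π * c * |ξ|)) ^ (k + 1) := by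
  rw [fourier_bsplineDensity, norm_pow, norm_fourier_unifDensity_eq hc hξ]

/-! ## The profile and its first moment, sines kept -/

variable {c₁ m₀ c₂ ε α : ℝ} {m : ℕ}

/-- **E1's profile bound**: for `m ≥ 1`, `ε > 0`, `c₁ + ε ≤ m₀ ≤ c₂ − ε`, `ξ ≠ 0`,
`‖𝓕h(ξ)‖ ≤ ((1+|α|)/(π|ξ|))·(|sin(2π(ε/m)ξ)|·m/(2πε|ξ|))^m` (`h = profile c₁ m₀ c₂ ε α m`). [folklore; THETA-CERT-cc6 §E1] -/
theorem norm_fourier_profile_le_sine (hm : 1 ≤ m) (hε : 0 < ε) (h1 : m₀ ≤ c₂ - ε) (h2 : c₁ + ε ≤ m₀) {ξ : ℝ} (hξ : ξ ≠ 0) :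
    ‖𝓕 (profile c₁ m₀ c₂ ε α m) ξ‖ ≤
      (1 + |α|) / (π * |ξ|) * (|Real.sin (2 * π * (ε / m) * ξ)| * (m / (2 * π * ε * |ξ|))) ^ m := by
  have hm' : (0 : ℝ) < m := by exact_mod_cast hm
  have hc : 0 < ε / m := div_pos hε hm'
  rw [profile, weilConv, Real.fourier_mul_convolution_eq (integrable_stepProfile _ _ _ _ _) (integrable_bsplineDensity _ _),
    norm_mul]
  have hk : m - 1 + 1 = m := Nat.sub_add_cancel hm
  have hB := norm_fourier_bsplineDensity_eq hc (m - 1) hξ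
  rw [hk] at hB
  have hB' : ‖𝓕 (bsplineDensity (ε / m) (m - 1)) ξ‖ = (|Real.sin (2 * π * (ε / m) * ξ)| * (m / (2 * π * ε * |ξ|))) ^ m := by
    rw [hB]
    congr 1
    field_simp
  rw [hB']
  exact mul_le_mul_of_nonneg_right (norm_fourier_stepProfile_le h1 h2 hξ) (by positivity)

/-- **`‖𝓕[y·bspline_{c,k}](ξ)‖ ≤ (k+1)·(|sin(2πcξ)|/(2πc|ξ|))^k·(1/(2π|ξ|))·(1 + 1/(2πc|ξ|))`** (`c > 0`, `ξ ≠ 0`): the chain rule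
`𝓕[y·bspline] = (k+1)(𝓕 unif)^k 𝓕[y·unif]` (`fourier_mulId_bsplineDensity`, p420170) with the `k` plain factors exact. [folklore] -/
theorem norm_fourier_mulId_bsplineDensity_le_sine {c : ℝ} (hc : 0 < c) (k : ℕ) {ξ : ℝ} (hξ : ξ ≠ 0) :
    ‖𝓕 (mulId (bsplineDensity c k)) ξ‖ ≤
      (k + 1) * (|Real.sin (2 * π * c * ξ)| / (2 * π * c * |ξ|)) ^ k * (1 / (2 * π * |ξ|) * (1 + 1 / (2 * π * c * |ξ|))) := by
  rw [fourier_mulId_bsplineDensity hc.le k ξ, norm_mul, norm_mul, norm_pow, norm_fourier_unifDensity_eq hc hξ]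
  have hk : ‖((k : ℂ) + 1)‖ = (k : ℝ) + 1 := by
    rw [show ((k : ℂ) + 1) = ((k + 1 : ℕ) : ℂ) by push_cast; ring, Complex.norm_natCast]; push_cast; ring
  rw [hk]
  exact mul_le_mul_of_nonneg_left (norm_fourier_mulId_unifDensity_le hc hξ) (by positivity)

/-- **E1's moment bound** (the derivative majorant's input, sines kept): for `φ(y) = y·h′(y)`, `m ≥ 1`, `ε > 0`, `0 ≤ c₁`,
`c₁ + ε ≤ m₀ ≤ c₂ − ε`, `α ≥ 0`, `ξ ≠ 0`: `‖𝓕φ(ξ)‖ ≤ (2+2α)·X^m·(c₂ s^m + ε s^{m−1}(1 + X))`, `X = m/(2πε|ξ|)`,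
`s = |sin(2π(ε/m)ξ)|` (THETA-CERT-cc6 §E1: `|ρ̂′(ζ)| ≤ |sin(ζ/m)|^{m−1}(m/ζ)^m(1 + m/ζ)`). [folklore; THETA-CERT-cc6 §E1] -/
theorem norm_fourier_momentProfile_le_sine (hm : 1 ≤ m) (hε : 0 < ε) (hc₁ : 0 ≤ c₁) (h2 : c₁ + ε ≤ m₀) (h1 : m₀ ≤ c₂ - ε)
    (hα : 0 ≤ α) {ξ : ℝ} (hξ : ξ ≠ 0) :
    ‖𝓕 (mulId (profileDeriv c₁ m₀ c₂ ε α m)) ξ‖ ≤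
      (2 + 2 * α) * (m / (2 * π * ε * |ξ|)) ^ m *
        (c₂ * |Real.sin (2 * π * (ε / m) * ξ)| ^ m +
          ε * |Real.sin (2 * π * (ε / m) * ξ)| ^ (m - 1) * (1 + m / (2 * π * ε * |ξ|))) := by
  have hm' : (0 : ℝ) < m := by exact_mod_cast hm
  have hc : 0 < ε / m := div_pos hε hm'
  have hρ : Integrable (profileDensity ε m) := integrable_bsplineDensity _ _
  have hρ' : Integrable (mulId (profileDensity ε m)) := integrable_mulId_bsplineDensity hc.le _
  set X : ℝ := m / (2 * π * ε * |ξ|) with hX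
  set s : ℝ := |Real.sin (2 * π * (ε / m) * ξ)| with hs
  have hX0 : 0 ≤ X := by positivity
  have hs0 : 0 ≤ s := abs_nonneg _
  have hs1 : s ≤ 1 := Real.abs_sin_le_one _
  have hcX : 1 / (2 * π * (ε / m) * |ξ|) = X := by rw [hX]; field_simp
  have hk : ((m - 1 : ℕ) : ℝ) + 1 = m := by rw [Nat.cast_sub hm]; push_cast; ring
  -- the two elementary bounds, sines kept
  have hB1 : ‖𝓕 (profileDensity ε m) ξ‖ = s ^ m * X ^ m := by
    have := norm_fourier_bsplineDensity_eq hc (m - 1) hξ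
    rw [Nat.sub_add_cancel hm, ← hs, div_eq_mul_one_div s, hcX, mul_pow] at this
    exact this
  have hB2 : ‖𝓕 (mulId (profileDensity ε m)) ξ‖ ≤ ε * s ^ (m - 1) * X ^ m * (1 + X) := by
    have := norm_fourier_mulId_bsplineDensity_le_sine hc (m - 1) hξ
    rw [hk, ← hs, div_eq_mul_one_div s, hcX, mul_pow] at this
    refine this.trans (le_of_eq ?_)
    have hpow : X ^ m = X ^ (m - 1) * X := by rw [← pow_succ, Nat.sub_add_cancel hm]
    rw [hpow, hX]
    field_simp
  -- each shifted piece
  have hS : ∀ s₀ : ℝ, |s₀| ≤ c₂ →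
      ‖𝓕 (fun y : ℝ => (y : ℂ) * profileDensity ε m (y - s₀)) ξ‖ ≤ ε * s ^ (m - 1) * X ^ m * (1 + X) + c₂ * (s ^ m * X ^ m) := by
    intro s₀ hs₀
    refine (norm_fourier_mulId_comp_sub_le hρ hρ' s₀ ξ).trans ?_
    rw [hB1]
    have := mul_le_mul_of_nonneg_right hs₀ (by positivity : 0 ≤ s ^ m * X ^ m)
    linarith
  have hs₁ : |m₀| ≤ c₂ := by rw [abs_of_nonneg (by linarith)]; linarith
  have hs₂ : |c₂ - ε| ≤ c₂ := by rw [abs_of_nonneg (by linarith)]; linarith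
  have hs₃ : |c₁ + ε| ≤ c₂ := by rw [abs_of_nonneg (by linarith)]; linarith
  rw [fourier_mulId_profileDeriv hε.le]
  have hn1 : ‖(1 + (α : ℂ))‖ = 1 + α := by
    rw [show (1 + (α : ℂ)) = ((1 + α : ℝ) : ℂ) by push_cast; ring, Complex.norm_real, Real.norm_of_nonneg (by linarith)]
  have hnα : ‖(α : ℂ)‖ = α := by rw [Complex.norm_real, Real.norm_of_nonneg hα]
  calc ‖((1 + (α : ℂ)) * 𝓕 (fun y : ℝ => (y : ℂ) * profileDensity ε m (y - m₀)) ξ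
          - 𝓕 (fun y : ℝ => (y : ℂ) * profileDensity ε m (y - (c₂ - ε))) ξ)
          - (α : ℂ) * 𝓕 (fun y : ℝ => (y : ℂ) * profileDensity ε m (y - (c₁ + ε))) ξ‖
        ≤ (‖(1 + (α : ℂ))‖ * ‖𝓕 (fun y : ℝ => (y : ℂ) * profileDensity ε m (y - m₀)) ξ‖
          + ‖𝓕 (fun y : ℝ => (y : ℂ) * profileDensity ε m (y - (c₂ - ε))) ξ‖)
          + ‖(α : ℂ)‖ * ‖𝓕 (fun y : ℝ => (y : ℂ) * profileDensity ε m (y - (c₁ + ε))) ξ‖ := by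
          refine (norm_sub_le _ _).trans (add_le_add ((norm_sub_le _ _).trans (add_le_add ?_ le_rfl)) ?_)
          · rw [norm_mul]
          · rw [norm_mul]
    _ ≤ ((1 + α) * (ε * s ^ (m - 1) * X ^ m * (1 + X) + c₂ * (s ^ m * X ^ m))
          + (ε * s ^ (m - 1) * X ^ m * (1 + X) + c₂ * (s ^ m * X ^ m)))
          + α * (ε * s ^ (m - 1) * X ^ m * (1 + X) + c₂ * (s ^ m * X ^ m)) := by
          rw [hn1, hnα]
          gcongr
          · exact hS _ hs₁
          · exact hS _ hs₂
          · exact hS _ hs₃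
    _ = (2 + 2 * α) * X ^ m * (c₂ * s ^ m + ε * s ^ (m - 1) * (1 + X)) := by ring

/-! ## Lattice sums: a symmetric termwise bound, then the `K`-harmonic split -/

/-- **Two-sided lattice sum from a symmetric termwise bound**: if `F 0 = 0` and `‖F(n/u)‖ ≤ a_{|n|}` for every integer `n ≠ 0`
with `Σ a` summable, then `n ↦ ‖F(n/u)‖` is summable over `ℤ` and `Σ_{n∈ℤ}‖F(n/u)‖ ≤ 2·Σ_{k≥0} a_{k+1}`. [folklore] -/
theorem summable_tsum_int_norm_le_of_bound {F : ℝ → ℂ} {u : ℝ} (a : ℕ → ℝ) (ha : Summable a)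
    (hF : ∀ n : ℤ, n ≠ 0 → ‖F (n / u)‖ ≤ a n.natAbs) (hF0 : F 0 = 0) :
    Summable (fun n : ℤ => ‖F (n / u)‖) ∧ ∑' n : ℤ, ‖F (n / u)‖ ≤ 2 * ∑' k : ℕ, a (k + 1) := by
  set A : ℤ → ℝ := fun n => ‖F (n / u)‖ with hA
  set b : ℕ → ℝ := fun k => a (k + 1) with hb
  have hbs : Summable b := (summable_nat_add_iff 1).mpr ha
  have key : ∀ k : ℕ, ‖F ((((k : ℤ) + 1 : ℤ) : ℝ) / u)‖ ≤ b k ∧ ‖F (((-((k : ℤ) + 1) : ℤ) : ℝ) / u)‖ ≤ b k := by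
    intro k
    have hne : ((k : ℤ) + 1 : ℤ) ≠ 0 := by omega
    have hne' : (-((k : ℤ) + 1) : ℤ) ≠ 0 := by omega
    have h1 := hF _ hne
    have h2 := hF _ hne'
    have e1 : ((k : ℤ) + 1 : ℤ).natAbs = k + 1 := by omega
    have e2 : (-((k : ℤ) + 1) : ℤ).natAbs = k + 1 := by omega
    rw [e1] at h1
    rw [e2] at h2
    exact ⟨h1, h2⟩
  have hA0 : A 0 = 0 := by simp [hA, hF0]
  have hAnonneg : ∀ n, 0 ≤ A n := fun n => norm_nonneg _
  have hs1 : Summable fun k : ℕ => A ((k : ℤ) + 1) :=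
    Summable.of_nonneg_of_le (fun k => hAnonneg _) (fun k => (key k).1) hbs
  have hs1' : Summable fun k : ℕ => A k := by
    rw [← summable_nat_add_iff 1]
    refine hs1.congr fun k => ?_
    push_cast; rfl
  have hs2 : Summable fun k : ℕ => A (-((k : ℤ) + 1)) :=
    Summable.of_nonneg_of_le (fun k => hAnonneg _) (fun k => (key k).2) hbs
  have hsum : Summable A := Summable.of_nat_of_neg_add_one hs1' hs2
  refine ⟨hsum, ?_⟩
  rw [tsum_of_nat_of_neg_add_one hs1' hs2, Summable.tsum_eq_zero_add hs1']
  have e0 : A ((0 : ℕ) : ℤ) = 0 := by simpa using hA0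
  rw [e0, zero_add]
  have t1 : ∑' k : ℕ, A (((k + 1 : ℕ) : ℤ)) ≤ ∑' k : ℕ, b k :=
    Summable.tsum_le_tsum (fun k => by
        have h := (key k).1
        simp only [hA]
        push_cast at h ⊢
        exact h)
      (by refine hs1.congr fun k => ?_; push_cast; rfl) hbs
  have t2 : ∑' k : ℕ, A (-((k : ℤ) + 1)) ≤ ∑' k : ℕ, b k := Summable.tsum_le_tsum (fun k => (key k).2) hs2 hbs
  simp only [hb] at t1 t2
  linarith

/-- **The `K`-split of a majorised series**: for summable `a`, `b` with `a_k ≤ b_k` for `k > K`,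
`Σ_{k≥0} a_{k+1} ≤ Σ_{k=1}^{K} a_k + (Σ_{k≥0} b_{k+1} − Σ_{k=1}^{K} b_k)` — keep the first `K` terms, majorise the tail. [folklore] -/
theorem tsum_succ_le_sum_Ico_add_sub {a b : ℕ → ℝ} (ha : Summable a) (hb : Summable b) {K : ℕ}
    (hab : ∀ k, K + 1 ≤ k → a k ≤ b k) :
    ∑' k : ℕ, a (k + 1) ≤ (∑ k ∈ Ico 1 (K + 1), a k) + ((∑' k : ℕ, b (k + 1)) - ∑ k ∈ Ico 1 (K + 1), b k) := by
  have ha1 : Summable fun k : ℕ => a (k + 1) := (summable_nat_add_iff 1).mpr ha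
  have hb1 : Summable fun k : ℕ => b (k + 1) := (summable_nat_add_iff 1).mpr hb
  have sa := (ha1.sum_add_tsum_nat_add K).symm
  have sb := (hb1.sum_add_tsum_nat_add K).symm
  have ea : ∑ i ∈ Finset.range K, a (i + 1) = ∑ k ∈ Ico 1 (K + 1), a k := by
    rw [Finset.sum_Ico_eq_sum_range]
    refine Finset.sum_congr (by simp) fun i _ => by rw [add_comm]
  have eb : ∑ i ∈ Finset.range K, b (i + 1) = ∑ k ∈ Ico 1 (K + 1), b k := by
    rw [Finset.sum_Ico_eq_sum_range]
    refine Finset.sum_congr (by simp) fun i _ => by rw [add_comm]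
  have htail : ∑' i : ℕ, a (i + K + 1) ≤ ∑' i : ℕ, b (i + K + 1) :=
    Summable.tsum_le_tsum (fun i => hab _ (by omega)) ((summable_nat_add_iff (K + 1)).mpr ha)
      ((summable_nat_add_iff (K + 1)).mpr hb)
  rw [sa, sb, ea, eb]
  have e1 : (fun i : ℕ => a (i + K + 1)) = fun i : ℕ => a (i + K + 1) := rfl
  simp only [add_assoc] at htail ⊢
  linarith

/-- The `p`-series comparison step: for `w ≤ 1`, `D ≥ 0`, `x ≥ 0`, `D·w/x ≤ D/x`. [folklore] -/
theorem mul_div_pow_le_of_le_one {D w x : ℝ} (hD : 0 ≤ D) (hw : w ≤ 1) (hx : 0 ≤ x) :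
    D * w / x ≤ D / x := by
  rcases eq_or_lt_of_le hx with h | h
  · simp [← h]
  · exact div_le_div_of_nonneg_right (by nlinarith) h.le

/-- Summability of `k ↦ 1/k^s` over `ℕ` for `2 ≤ s` (junk value `1/0^s = 0` at `k = 0` included). [folklore] -/
theorem summable_one_div_nat_pow' {s : ℕ} (hs : 2 ≤ s) : Summable fun k : ℕ => 1 / (k : ℝ) ^ s :=
  Real.summable_one_div_nat_pow.mpr (by omega)

/-- `Σ_{k≥0} 1/(k+1)^s` is the tree's `zetaTail s` shape: `∑' k, (fun k => 1/k^s) (k+1) = ∑' k, 1/((k:ℝ)+1)^s`. [folklore] -/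
theorem tsum_one_div_succ_pow (s : ℕ) :
    ∑' k : ℕ, (fun k : ℕ => 1 / (k : ℝ) ^ s) (k + 1) = ∑' k : ℕ, 1 / ((k : ℝ) + 1) ^ s := by
  refine tsum_congr fun k => ?_
  push_cast
  rfl

end Summit.RiemannHypothesis.RiemannHypothesis.Theorems.WeilColumn.ThetaMellin
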